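import Summits.QuantumFields.BalabanUV.Beta.GAN24.PairingCellTransfer

/-!
# `BalabanUV.Beta.GAN24.FaceWordBondPush` — binder row G-an2-4 ∕ (CONV-C), W-slot (α-0), ROW (C)sym AT LEVELS `≥ 1` (rows T6-STEP of the OWNER's
# two-index tower, RULING R-gan24p1-g40-1): **A FACE-WEIGHTED BOND SUM IS PUSHED THROUGH THE FACE PAIRING OF A WORD** — Part 45a of
# `GAN24/FourFaceGaugeSectors` (G-an2-4 CRUX TEAM (2), leaf prover `b2b-balaban-gan24-formalise-leaf-02`, gen 69; journal [LEAF02-G69-STAGED1] «NEXT»)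

NOT IN PRINT; OUR BOOKKEEPING ([folklore] dominated Fubini BY NAME over an2's `ExpKernelCalculus.biLoc_comp_biLoc ∕ biLoc_comp_right ∕ biLoc_comp_decays`,
an4's `KernelWard.comp_assoc_bdb`, leaf-06's `KernelLegCharges.summable_exp_coarse`; 0 `def`, 0 cited fact, 0 `def … : Prop`, 0 sorry).  HONEST FRAMING (cell
contract, verbatim): «discharging `BetaPertH` makes Bałaban's UV stability UNCONDITIONAL — a real constructive-QFT result; it is NOT the continuum limit and NOT
the Clay problem.»  HONEST DEPENDENCY (verbatim): «continuum YM on T⁴ ⇐ BetaPertH ∧ nine spine estimates (0/9 proved); BetaPertH ⇐ (D1) ∧ (D4) ∧ CAP+tail;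
G-an2-4 gates asym, D1 and NE2/3/4.»

WHY.  leaf-06 K6c (`FourFaceSourceWords.fourFace_dressedSource_inl_inl`, at any coarse face period `P` through K6b's weights) opens road-P2's face read
`FF_P(b̃_i)` of the E-frame forcing into three words whose two exchange words are face pairings of `(dM_μ,r′ ∘ X̃) ∘ dM_ν,u′` — DRESSED vertices `dM` at the
COARSE bonds, summed against the period-`P` exit-face weights, legs one class deeper.  leaf-06 K1a (`DressedVertexFaceBondSum.tsum_faceBond_vertexOfK_dressedStep`
✓) pushes ONE such bond sum ENTRYWISE onto the fine table: `Σ'_{u′} χ_P(u′_ν)·vertexOfK X̃ Lc S ν u′ = K·Σ'_t χ_{Lc·P}(t_ν)·S ν t` (the multiplier vertex dies by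
road-P2's `tsum_coord_colM`).  THIS FILE pushes an entrywise bond law THROUGH the face pairing of the word (the leg pair sum and the composition's internal
sums), for a GENERIC coarse bond family `E u` (uniformly bi-localised at centres `c u` with `Σ_u e^{−ε|c u − q|₁} < ∞`), a generic left factor `A` ∕ right
factor `B` bi-localised at a point, and BOUNDED weights `w` (bond) and `m` (leg pair) — so that Part 45 ∕ the assembler can turn K6c's words into
`K²·(EE₁ + EE₂)` of Part 44 `FacePairingPairForm` at the deep period `N = Lc·P`:
* §1 `summable_shear_pair`, **`tsum_weight_facePair_comp_right`** (EXPOSURE OF A RIGHT BOND FAMILY):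
  `Σ'_u w u·Σ'_{(y,w′)} m(y,w′)·(A ∘ E u)(y,w′)(a,b) = Σ'_{(y,w′)} m(y,w′)·Σ'_{x′} Σ_f A(y,x′)(a,f)·(Σ'_u w u·E u (x′,w′)(f,b))`;
* §2 **`tsum_weight_facePair_comp_left`** (EXPOSURE OF A LEFT BOND FAMILY):
  `Σ'_u w u·Σ'_{(y,w′)} m(y,w′)·(E u ∘ B)(y,w′)(a,b) = Σ'_{(y,w′)} m(y,w′)·Σ'_x Σ_f (Σ'_u w u·E u (y,x)(a,f))·B(x,w′)(f,b)`;
* §3 **`push_right_facePair`** ∕ **`push_left_facePair`**: given an ENTRYWISE push law `Σ'_u w u·E u = K·Σ'_t w′ t·S t` (hypothesis `hpush`, K1a's shape) the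
  face pairing of `(Dl ∘ X) ∘ E u` ∕ `(E u ∘ X) ∘ Er` summed against `w` is `K` times the face pairing of `(Dl ∘ X) ∘ S t` ∕ `(S t ∘ X) ∘ Er` summed against `w′`
  (`comp_assoc_bdb` for the left version).
Asserts NO value of any table; discharges NOTHING of (C)_{≥1} ∕ `hstep` ∕ `hSrc` ∕ `hSrcX` ∕ (Q-L) ∕ (hW, hWall); NEVER «G-an2-4 closed» as (CONV-C); NOT D1, NOT `BetaPertH`,
NOT continuum, NOT Clay.  2026-08-24; no existing file touched.
-/

noncomputable section

open Finset
open scoped BigOperators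
open Literature.MathematicalPhysics.QuantumFieldTheory
open Literature.MathematicalPhysics.QuantumFieldTheory.Balaban1983to89
open Literature.MathematicalPhysics.QuantumFieldTheory.Balaban1983to89.Beta
open B12Sec2to5 (l1 l1_nonneg)
open ExpKernelCalculus (Site MKer Decays BiLoc comp biLoc_comp_decays biLoc_comp_biLoc l1_sub_symm Zl Zl_nonneg summable_exp_shift summable_exp_shift')
open OneStepResolventKernel (Fib LocStencil biLoc_mono)
open BalabanStepJetsSucc (biLoc_comp_right)
open KernelWard (comp_assoc_bdb)

namespace Summit.QuantumFields.BalabanUV.Beta.GAN24.FaceWordBondPush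

variable {d : ℕ}

/-! ## §1 Exposure of a right bond family through the face pairing -/

section Expose

variable {A B : MKer (d + 1) (Fib d)} {E : Site (d + 1) → MKer (d + 1) (Fib d)} {c : Site (d + 1) → Site (d + 1)} {p q : Site (d + 1)}
  {CA CB CE δ : ℝ}

/-- [folklore] A product majorant sheared along the centres: `(u,(y,w′)) ↦ g u·(h₁ y·h₂ (w′ − c u))` is summable when `g`, `h₁`, `h₂` are nonnegative and summable. -/
theorem summable_shear_pair {g h₁ h₂ : Site (d + 1) → ℝ} (c : Site (d + 1) → Site (d + 1)) (hg : Summable g) (h1 : Summable h₁) (h2 : Summable h₂)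
    (hg0 : ∀ u, 0 ≤ g u) (h10 : ∀ y, 0 ≤ h₁ y) (h20 : ∀ w, 0 ≤ h₂ w) :
    Summable fun s : Site (d + 1) × (Site (d + 1) × Site (d + 1)) => g s.1 * (h₁ s.2.1 * h₂ (s.2.2 - c s.1)) := by
  let e : Site (d + 1) × (Site (d + 1) × Site (d + 1)) ≃ Site (d + 1) × (Site (d + 1) × Site (d + 1)) :=
    { toFun := fun s => (s.1, (s.2.1, s.2.2 - c s.1))
      invFun := fun s => (s.1, (s.2.1, s.2.2 + c s.1))
      left_inv := fun s => by
        show (s.1, (s.2.1, s.2.2 - c s.1 + c s.1)) = s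
        rw [sub_add_cancel]
      right_inv := fun s => by
        show (s.1, (s.2.1, s.2.2 + c s.1 - c s.1)) = s
        rw [add_sub_cancel_right] }
  have hh : Summable fun yw : Site (d + 1) × Site (d + 1) => h₁ yw.1 * h₂ yw.2 := h1.mul_of_nonneg h2 h10 h20
  have hprod : Summable fun s : Site (d + 1) × (Site (d + 1) × Site (d + 1)) => g s.1 * (h₁ s.2.1 * h₂ s.2.2) :=
    Summable.mul_of_nonneg (f := g) (g := fun yw : Site (d + 1) × Site (d + 1) => h₁ yw.1 * h₂ yw.2) hg hh hg0
      (fun yw => mul_nonneg (h10 _) (h20 _))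
  exact ((e.summable_iff).2 hprod).congr fun s => rfl

/-- [folklore] The same with the shear on the FIRST leg: `(u,(y,w′)) ↦ g u·(h₁ (y − c u)·h₂ w′)`. -/
theorem summable_shear_pair_fst {g h₁ h₂ : Site (d + 1) → ℝ} (c : Site (d + 1) → Site (d + 1)) (hg : Summable g) (h1 : Summable h₁) (h2 : Summable h₂)
    (hg0 : ∀ u, 0 ≤ g u) (h10 : ∀ y, 0 ≤ h₁ y) (h20 : ∀ w, 0 ≤ h₂ w) :
    Summable fun s : Site (d + 1) × (Site (d + 1) × Site (d + 1)) => g s.1 * (h₁ (s.2.1 - c s.1) * h₂ s.2.2) := by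
  let e : Site (d + 1) × (Site (d + 1) × Site (d + 1)) ≃ Site (d + 1) × (Site (d + 1) × Site (d + 1)) :=
    { toFun := fun s => (s.1, (s.2.1 - c s.1, s.2.2))
      invFun := fun s => (s.1, (s.2.1 + c s.1, s.2.2))
      left_inv := fun s => by
        show (s.1, (s.2.1 - c s.1 + c s.1, s.2.2)) = s
        rw [sub_add_cancel]
      right_inv := fun s => by
        show (s.1, (s.2.1 + c s.1 - c s.1, s.2.2)) = s
        rw [add_sub_cancel_right] }
  have hh : Summable fun yw : Site (d + 1) × Site (d + 1) => h₁ yw.1 * h₂ yw.2 := h1.mul_of_nonneg h2 h10 h20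
  have hprod : Summable fun s : Site (d + 1) × (Site (d + 1) × Site (d + 1)) => g s.1 * (h₁ s.2.1 * h₂ s.2.2) :=
    Summable.mul_of_nonneg (f := g) (g := fun yw : Site (d + 1) × Site (d + 1) => h₁ yw.1 * h₂ yw.2) hg hh hg0
      (fun yw => mul_nonneg (h10 _) (h20 _))
  exact ((e.summable_iff).2 hprod).congr fun s => rfl

/-- [folklore] Pulling a scalar through `Σ'_{x′} Σ_f F·(K·T)`. -/
theorem pull_const_right (mv K : ℝ) (F T : Site (d + 1) → Fib d → ℝ) :
    mv * ∑' x' : Site (d + 1), ∑ f : Fib d, F x' f * (K * T x' f) = K * (mv * ∑' x' : Site (d + 1), ∑ f : Fib d, F x' f * T x' f) := by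
  have h : ∑' x' : Site (d + 1), ∑ f : Fib d, F x' f * (K * T x' f) = K * ∑' x' : Site (d + 1), ∑ f : Fib d, F x' f * T x' f := by
    rw [← tsum_mul_left]
    refine tsum_congr fun x' => ?_
    rw [Finset.mul_sum]
    exact Finset.sum_congr rfl fun f _ => by ring
  rw [h]; ring

/-- [folklore] Pulling a scalar through `Σ'_x Σ_f (K·T)·B`. -/
theorem pull_const_left (mv K : ℝ) (T B : Site (d + 1) → Fib d → ℝ) :
    mv * ∑' x : Site (d + 1), ∑ f : Fib d, (K * T x f) * B x f = K * (mv * ∑' x : Site (d + 1), ∑ f : Fib d, T x f * B x f) := by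
  have h : ∑' x : Site (d + 1), ∑ f : Fib d, (K * T x f) * B x f = K * ∑' x : Site (d + 1), ∑ f : Fib d, T x f * B x f := by
    rw [← tsum_mul_left]
    refine tsum_congr fun x => ?_
    rw [Finset.mul_sum]
    exact Finset.sum_congr rfl fun f _ => by ring
  rw [h]; ring

/-- [folklore] `Σ_w e^{−δ|w|₁}` converges. -/
theorem summable_exp_l1 (hδ : 0 < δ) : Summable fun w : Site (d + 1) => Real.exp (-δ * l1 w) := by
  have := summable_exp_shift' hδ (0 : Site (d + 1))
  simpa only [sub_zero] using this

/-- NOT IN PRINT; OUR BOOKKEEPING.  **EXPOSURE OF A RIGHT BOND FAMILY THROUGH THE FACE PAIRING** (`A` bi-localised at `(p,p)`, the family `E u` uniformly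
bi-localised at centres `c u` with summable `e^{−ε|c u − q|₁}` for every `q` and `ε > 0`, common rate `δ > 0`, weights `|w| ≤ 1`, `|m| ≤ 1`):
`Σ'_u w u·Σ'_{(y,w′)} m(y,w′)·(A ∘ E u)(y,w′)(a,b) = Σ'_{(y,w′)} m(y,w′)·Σ'_{x′} Σ_f A(y,x′)(a,f)·(Σ'_u w u·E u (x′,w′)(f,b))` (two dominated exchanges). -/
theorem tsum_weight_facePair_comp_right (hA : BiLoc A p p CA δ) (hE : ∀ u, BiLoc (E u) (c u) (c u) CE δ) (hδ : 0 < δ)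
    (hc : ∀ (q : Site (d + 1)) (ε : ℝ), 0 < ε → Summable fun u : Site (d + 1) => Real.exp (-ε * l1 (c u - q)))
    (w : Site (d + 1) → ℝ) (hw : ∀ u, |w u| ≤ 1) (m : Site (d + 1) × Site (d + 1) → ℝ) (hm : ∀ yw, |m yw| ≤ 1) (a b : Fib d) :
    ∑' u : Site (d + 1), w u * ∑' yw : Site (d + 1) × Site (d + 1), m yw * comp A (E u) yw.1 yw.2 a b
      = ∑' yw : Site (d + 1) × Site (d + 1), m yw * ∑' x' : Site (d + 1), ∑ f : Fib d, A yw.1 x' a f * ∑' u : Site (d + 1), w u * E u x' yw.2 f b := by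
  classical
  have hCA : 0 ≤ CA := hA.nonneg a
  have hCE : 0 ≤ CE := (hE 0).nonneg a
  -- (i) the outer exchange `u ↔ (y,w′)`: the composite `A ∘ E u` is bi-localised at `(p, c u)` with the inner-distance factor
  set K₁ : ℝ := (Fintype.card (Fib d) : ℝ) * (CA * CE) * Zl (d + 1) (δ / 2) with hK₁
  have hT : ∀ u, BiLoc (comp A (E u)) p (c u) (K₁ * Real.exp (-(δ / 2) * l1 (p - c u))) δ := fun u => biLoc_comp_biLoc hA (hE u) hδ
  have hF : Summable fun s : Site (d + 1) × (Site (d + 1) × Site (d + 1)) => w s.1 * (m s.2 * comp A (E s.1) s.2.1 s.2.2 a b) := by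
    have hM := summable_shear_pair (g := fun u => Real.exp (-(δ / 2) * l1 (c u - p))) (h₁ := fun y => Real.exp (-δ * l1 (y - p)))
      (h₂ := fun w => Real.exp (-δ * l1 w)) c (hc p (δ / 2) (half_pos hδ)) (summable_exp_shift' hδ p) (summable_exp_l1 hδ)
      (fun _ => (Real.exp_pos _).le) (fun _ => (Real.exp_pos _).le) (fun _ => (Real.exp_pos _).le)
    refine Summable.of_norm_bounded (hM.mul_left K₁) (fun s => ?_)
    rw [Real.norm_eq_abs, abs_mul, abs_mul]
    have h := hT s.1 s.2.1 s.2.2 a b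
    rw [l1_sub_symm p (c s.1)] at h
    have h0 : 0 ≤ K₁ * Real.exp (-(δ / 2) * l1 (c s.1 - p)) * Real.exp (-δ * (l1 (s.2.1 - p) + l1 (s.2.2 - c s.1))) := (abs_nonneg _).trans h
    calc |w s.1| * (|m s.2| * |comp A (E s.1) s.2.1 s.2.2 a b|)
        ≤ 1 * (1 * (K₁ * Real.exp (-(δ / 2) * l1 (c s.1 - p)) * Real.exp (-δ * (l1 (s.2.1 - p) + l1 (s.2.2 - c s.1))))) :=
          mul_le_mul (hw _) (mul_le_mul (hm _) h (abs_nonneg _) zero_le_one) (mul_nonneg (abs_nonneg _) (abs_nonneg _)) zero_le_one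
      _ = K₁ * (Real.exp (-(δ / 2) * l1 (c s.1 - p)) * (Real.exp (-δ * l1 (s.2.1 - p)) * Real.exp (-δ * l1 (s.2.2 - c s.1)))) := by
          rw [one_mul, one_mul, mul_add, Real.exp_add]; ring
  have hF' : Summable (Function.uncurry fun (u : Site (d + 1)) (yw : Site (d + 1) × Site (d + 1)) => w u * (m yw * comp A (E u) yw.1 yw.2 a b)) := hF
  have step1 : ∑' u : Site (d + 1), w u * ∑' yw : Site (d + 1) × Site (d + 1), m yw * comp A (E u) yw.1 yw.2 a b
      = ∑' yw : Site (d + 1) × Site (d + 1), ∑' u : Site (d + 1), w u * (m yw * comp A (E u) yw.1 yw.2 a b) := by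
    rw [show (∑' u : Site (d + 1), w u * ∑' yw : Site (d + 1) × Site (d + 1), m yw * comp A (E u) yw.1 yw.2 a b)
        = ∑' u : Site (d + 1), ∑' yw : Site (d + 1) × Site (d + 1), w u * (m yw * comp A (E u) yw.1 yw.2 a b)
        from tsum_congr fun u => tsum_mul_left.symm]
    exact hF'.tsum_comm.symm
  rw [step1]
  refine tsum_congr fun yw => ?_
  -- (ii) the inner exchange `u ↔ x′` at fixed legs `(y, w′)`
  have step2 : ∑' u : Site (d + 1), w u * (m yw * comp A (E u) yw.1 yw.2 a b)
      = m yw * ∑' u : Site (d + 1), ∑' x' : Site (d + 1), ∑ f : Fib d, w u * (A yw.1 x' a f * E u x' yw.2 f b) := by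
    rw [← tsum_mul_left]
    refine tsum_congr fun u => ?_
    have hc' : comp A (E u) yw.1 yw.2 a b = ∑' x' : Site (d + 1), ∑ f : Fib d, A yw.1 x' a f * E u x' yw.2 f b := rfl
    rw [hc', ← tsum_mul_left, ← tsum_mul_left, ← tsum_mul_left]
    refine tsum_congr fun x' => ?_
    rw [Finset.mul_sum, Finset.mul_sum, Finset.mul_sum]
    exact Finset.sum_congr rfl fun f _ => by ring
  rw [step2]
  congr 1
  have hG : Summable fun s : Site (d + 1) × Site (d + 1) => ∑ f : Fib d, w s.1 * (A yw.1 s.2 a f * E s.1 s.2 yw.2 f b) := by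
    have hg : Summable fun s : Site (d + 1) × Site (d + 1) => Real.exp (-δ * l1 (c s.1 - yw.2)) * Real.exp (-δ * l1 (s.2 - p)) :=
      (hc yw.2 δ hδ).mul_of_nonneg (summable_exp_shift' hδ p) (fun _ => (Real.exp_pos _).le) (fun _ => (Real.exp_pos _).le)
    refine Summable.of_norm_bounded (hg.mul_left ((Fintype.card (Fib d) : ℝ) * (CA * CE))) (fun s => ?_)
    rw [Real.norm_eq_abs]
    refine (Finset.abs_sum_le_sum_abs _ _).trans ?_
    have hterm : ∀ f : Fib d, |w s.1 * (A yw.1 s.2 a f * E s.1 s.2 yw.2 f b)| ≤ (CA * CE) * (Real.exp (-δ * l1 (c s.1 - yw.2)) * Real.exp (-δ * l1 (s.2 - p))) := by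
      intro f
      have h1 := hA yw.1 s.2 a f
      have h2 := hE s.1 s.2 yw.2 f b
      have h1' : |A yw.1 s.2 a f| ≤ CA * Real.exp (-δ * l1 (s.2 - p)) := by
        refine h1.trans (mul_le_mul_of_nonneg_left (Real.exp_le_exp.mpr ?_) hCA)
        nlinarith [l1_nonneg (yw.1 - p), hδ.le]
      have h2' : |E s.1 s.2 yw.2 f b| ≤ CE * Real.exp (-δ * l1 (c s.1 - yw.2)) := by
        refine h2.trans (mul_le_mul_of_nonneg_left (Real.exp_le_exp.mpr ?_) hCE)
        rw [l1_sub_symm (c s.1) yw.2]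
        nlinarith [l1_nonneg (s.2 - c s.1), hδ.le]
      rw [abs_mul, abs_mul]
      calc |w s.1| * (|A yw.1 s.2 a f| * |E s.1 s.2 yw.2 f b|) ≤ 1 * ((CA * Real.exp (-δ * l1 (s.2 - p))) * (CE * Real.exp (-δ * l1 (c s.1 - yw.2)))) :=
            mul_le_mul (hw _) (mul_le_mul h1' h2' (abs_nonneg _) ((abs_nonneg _).trans h1')) (mul_nonneg (abs_nonneg _) (abs_nonneg _)) zero_le_one
        _ = (CA * CE) * (Real.exp (-δ * l1 (c s.1 - yw.2)) * Real.exp (-δ * l1 (s.2 - p))) := by ring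
    calc ∑ f : Fib d, |w s.1 * (A yw.1 s.2 a f * E s.1 s.2 yw.2 f b)|
        ≤ ∑ _f : Fib d, (CA * CE) * (Real.exp (-δ * l1 (c s.1 - yw.2)) * Real.exp (-δ * l1 (s.2 - p))) := Finset.sum_le_sum fun f _ => hterm f
      _ = (Fintype.card (Fib d) : ℝ) * (CA * CE) * (Real.exp (-δ * l1 (c s.1 - yw.2)) * Real.exp (-δ * l1 (s.2 - p))) := by
          rw [Finset.sum_const, Finset.card_univ, nsmul_eq_mul]; ring
  have hG' : Summable (Function.uncurry fun (u : Site (d + 1)) (x' : Site (d + 1)) => ∑ f : Fib d, w u * (A yw.1 x' a f * E u x' yw.2 f b)) := hG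
  rw [← hG'.tsum_comm]
  refine tsum_congr fun x' => ?_
  -- (iii) the finite fibre sum out, the weight sum in
  have hslice : ∀ f : Fib d, Summable fun u : Site (d + 1) => w u * (A yw.1 x' a f * E u x' yw.2 f b) := by
    intro f
    refine Summable.of_norm_bounded ((hc yw.2 δ hδ).mul_left (CA * CE)) (fun u => ?_)
    rw [Real.norm_eq_abs, abs_mul, abs_mul]
    have h1 : |A yw.1 x' a f| ≤ CA := by
      refine (hA yw.1 x' a f).trans ?_
      have : Real.exp (-δ * (l1 (yw.1 - p) + l1 (x' - p))) ≤ 1 := by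
        rw [Real.exp_le_one_iff]; nlinarith [l1_nonneg (yw.1 - p), l1_nonneg (x' - p), hδ.le]
      nlinarith
    have h2 : |E u x' yw.2 f b| ≤ CE * Real.exp (-δ * l1 (c u - yw.2)) := by
      refine (hE u x' yw.2 f b).trans (mul_le_mul_of_nonneg_left (Real.exp_le_exp.mpr ?_) hCE)
      rw [l1_sub_symm (c u) yw.2]
      nlinarith [l1_nonneg (x' - c u), hδ.le]
    calc |w u| * (|A yw.1 x' a f| * |E u x' yw.2 f b|) ≤ 1 * (CA * (CE * Real.exp (-δ * l1 (c u - yw.2)))) :=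
          mul_le_mul (hw _) (mul_le_mul h1 h2 (abs_nonneg _) hCA) (mul_nonneg (abs_nonneg _) (abs_nonneg _)) zero_le_one
      _ = CA * CE * Real.exp (-δ * l1 (c u - yw.2)) := by ring
  rw [Summable.tsum_finsetSum (fun f _ => hslice f)]
  refine Finset.sum_congr rfl fun f _ => ?_
  rw [← tsum_mul_left]
  exact tsum_congr fun u => by ring

/-! ## §2 Exposure of a left bond family through the face pairing -/

/-- NOT IN PRINT; OUR BOOKKEEPING.  **EXPOSURE OF A LEFT BOND FAMILY THROUGH THE FACE PAIRING** (`B` bi-localised at `(q,q)`, the family `E u` uniformly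
bi-localised at centres `c u` as in §1, weights `|w| ≤ 1`, `|m| ≤ 1`):
`Σ'_u w u·Σ'_{(y,w′)} m(y,w′)·(E u ∘ B)(y,w′)(a,b) = Σ'_{(y,w′)} m(y,w′)·Σ'_x Σ_f (Σ'_u w u·E u (y,x)(a,f))·B(x,w′)(f,b)`. -/
theorem tsum_weight_facePair_comp_left (hB : BiLoc B q q CB δ) (hE : ∀ u, BiLoc (E u) (c u) (c u) CE δ) (hδ : 0 < δ)
    (hc : ∀ (q : Site (d + 1)) (ε : ℝ), 0 < ε → Summable fun u : Site (d + 1) => Real.exp (-ε * l1 (c u - q)))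
    (w : Site (d + 1) → ℝ) (hw : ∀ u, |w u| ≤ 1) (m : Site (d + 1) × Site (d + 1) → ℝ) (hm : ∀ yw, |m yw| ≤ 1) (a b : Fib d) :
    ∑' u : Site (d + 1), w u * ∑' yw : Site (d + 1) × Site (d + 1), m yw * comp (E u) B yw.1 yw.2 a b
      = ∑' yw : Site (d + 1) × Site (d + 1), m yw * ∑' x : Site (d + 1), ∑ f : Fib d, (∑' u : Site (d + 1), w u * E u yw.1 x a f) * B x yw.2 f b := by
  classical
  have hCB : 0 ≤ CB := hB.nonneg a
  have hCE : 0 ≤ CE := (hE 0).nonneg a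
  set K₁ : ℝ := (Fintype.card (Fib d) : ℝ) * (CE * CB) * Zl (d + 1) (δ / 2) with hK₁
  have hT : ∀ u, BiLoc (comp (E u) B) (c u) q (K₁ * Real.exp (-(δ / 2) * l1 (c u - q))) δ := fun u => biLoc_comp_biLoc (hE u) hB hδ
  -- (i) the outer exchange `u ↔ (y,w′)` — shear the FIRST leg along the centres
  have hF : Summable fun s : Site (d + 1) × (Site (d + 1) × Site (d + 1)) => w s.1 * (m s.2 * comp (E s.1) B s.2.1 s.2.2 a b) := by
    have hM' := summable_shear_pair_fst (g := fun u => Real.exp (-(δ / 2) * l1 (c u - q))) (h₁ := fun y => Real.exp (-δ * l1 y))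
      (h₂ := fun w' => Real.exp (-δ * l1 (w' - q))) c (hc q (δ / 2) (half_pos hδ)) (summable_exp_l1 hδ) (summable_exp_shift' hδ q)
      (fun _ => (Real.exp_pos _).le) (fun _ => (Real.exp_pos _).le) (fun _ => (Real.exp_pos _).le)
    refine Summable.of_norm_bounded (hM'.mul_left K₁) (fun s => ?_)
    rw [Real.norm_eq_abs, abs_mul, abs_mul]
    have h := hT s.1 s.2.1 s.2.2 a b
    have h0 : 0 ≤ K₁ * Real.exp (-(δ / 2) * l1 (c s.1 - q)) * Real.exp (-δ * (l1 (s.2.1 - c s.1) + l1 (s.2.2 - q))) := (abs_nonneg _).trans h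
    calc |w s.1| * (|m s.2| * |comp (E s.1) B s.2.1 s.2.2 a b|)
        ≤ 1 * (1 * (K₁ * Real.exp (-(δ / 2) * l1 (c s.1 - q)) * Real.exp (-δ * (l1 (s.2.1 - c s.1) + l1 (s.2.2 - q))))) :=
          mul_le_mul (hw _) (mul_le_mul (hm _) h (abs_nonneg _) zero_le_one) (mul_nonneg (abs_nonneg _) (abs_nonneg _)) zero_le_one
      _ = K₁ * (Real.exp (-(δ / 2) * l1 (c s.1 - q)) * (Real.exp (-δ * l1 (s.2.1 - c s.1)) * Real.exp (-δ * l1 (s.2.2 - q)))) := by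
          rw [one_mul, one_mul, mul_add, Real.exp_add]; ring
  have hF' : Summable (Function.uncurry fun (u : Site (d + 1)) (yw : Site (d + 1) × Site (d + 1)) => w u * (m yw * comp (E u) B yw.1 yw.2 a b)) := hF
  have step1 : ∑' u : Site (d + 1), w u * ∑' yw : Site (d + 1) × Site (d + 1), m yw * comp (E u) B yw.1 yw.2 a b
      = ∑' yw : Site (d + 1) × Site (d + 1), ∑' u : Site (d + 1), w u * (m yw * comp (E u) B yw.1 yw.2 a b) := by
    rw [show (∑' u : Site (d + 1), w u * ∑' yw : Site (d + 1) × Site (d + 1), m yw * comp (E u) B yw.1 yw.2 a b)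
        = ∑' u : Site (d + 1), ∑' yw : Site (d + 1) × Site (d + 1), w u * (m yw * comp (E u) B yw.1 yw.2 a b)
        from tsum_congr fun u => tsum_mul_left.symm]
    exact hF'.tsum_comm.symm
  rw [step1]
  refine tsum_congr fun yw => ?_
  -- (ii) the inner exchange `u ↔ x` at fixed legs
  have step2 : ∑' u : Site (d + 1), w u * (m yw * comp (E u) B yw.1 yw.2 a b)
      = m yw * ∑' u : Site (d + 1), ∑' x : Site (d + 1), ∑ f : Fib d, w u * (E u yw.1 x a f * B x yw.2 f b) := by
    rw [← tsum_mul_left]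
    refine tsum_congr fun u => ?_
    have hc' : comp (E u) B yw.1 yw.2 a b = ∑' x : Site (d + 1), ∑ f : Fib d, E u yw.1 x a f * B x yw.2 f b := rfl
    rw [hc', ← tsum_mul_left, ← tsum_mul_left, ← tsum_mul_left]
    refine tsum_congr fun x => ?_
    rw [Finset.mul_sum, Finset.mul_sum, Finset.mul_sum]
    exact Finset.sum_congr rfl fun f _ => by ring
  rw [step2]
  congr 1
  have hG : Summable fun s : Site (d + 1) × Site (d + 1) => ∑ f : Fib d, w s.1 * (E s.1 yw.1 s.2 a f * B s.2 yw.2 f b) := by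
    have hg : Summable fun s : Site (d + 1) × Site (d + 1) => Real.exp (-δ * l1 (c s.1 - yw.1)) * Real.exp (-δ * l1 (s.2 - q)) :=
      (hc yw.1 δ hδ).mul_of_nonneg (summable_exp_shift' hδ q) (fun _ => (Real.exp_pos _).le) (fun _ => (Real.exp_pos _).le)
    refine Summable.of_norm_bounded (hg.mul_left ((Fintype.card (Fib d) : ℝ) * (CE * CB))) (fun s => ?_)
    rw [Real.norm_eq_abs]
    refine (Finset.abs_sum_le_sum_abs _ _).trans ?_
    have hterm : ∀ f : Fib d, |w s.1 * (E s.1 yw.1 s.2 a f * B s.2 yw.2 f b)| ≤ (CE * CB) * (Real.exp (-δ * l1 (c s.1 - yw.1)) * Real.exp (-δ * l1 (s.2 - q))) := by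
      intro f
      have h1 : |E s.1 yw.1 s.2 a f| ≤ CE * Real.exp (-δ * l1 (c s.1 - yw.1)) := by
        refine (hE s.1 yw.1 s.2 a f).trans (mul_le_mul_of_nonneg_left (Real.exp_le_exp.mpr ?_) hCE)
        rw [l1_sub_symm (c s.1) yw.1]
        nlinarith [l1_nonneg (s.2 - c s.1), hδ.le]
      have h2 : |B s.2 yw.2 f b| ≤ CB * Real.exp (-δ * l1 (s.2 - q)) := by
        refine (hB s.2 yw.2 f b).trans (mul_le_mul_of_nonneg_left (Real.exp_le_exp.mpr ?_) hCB)
        nlinarith [l1_nonneg (yw.2 - q), hδ.le]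
      rw [abs_mul, abs_mul]
      calc |w s.1| * (|E s.1 yw.1 s.2 a f| * |B s.2 yw.2 f b|) ≤ 1 * ((CE * Real.exp (-δ * l1 (c s.1 - yw.1))) * (CB * Real.exp (-δ * l1 (s.2 - q)))) :=
            mul_le_mul (hw _) (mul_le_mul h1 h2 (abs_nonneg _) ((abs_nonneg _).trans h1)) (mul_nonneg (abs_nonneg _) (abs_nonneg _)) zero_le_one
        _ = (CE * CB) * (Real.exp (-δ * l1 (c s.1 - yw.1)) * Real.exp (-δ * l1 (s.2 - q))) := by ring
    calc ∑ f : Fib d, |w s.1 * (E s.1 yw.1 s.2 a f * B s.2 yw.2 f b)|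
        ≤ ∑ _f : Fib d, (CE * CB) * (Real.exp (-δ * l1 (c s.1 - yw.1)) * Real.exp (-δ * l1 (s.2 - q))) := Finset.sum_le_sum fun f _ => hterm f
      _ = (Fintype.card (Fib d) : ℝ) * (CE * CB) * (Real.exp (-δ * l1 (c s.1 - yw.1)) * Real.exp (-δ * l1 (s.2 - q))) := by
          rw [Finset.sum_const, Finset.card_univ, nsmul_eq_mul]; ring
  have hG' : Summable (Function.uncurry fun (u : Site (d + 1)) (x : Site (d + 1)) => ∑ f : Fib d, w u * (E u yw.1 x a f * B x yw.2 f b)) := hG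
  rw [← hG'.tsum_comm]
  refine tsum_congr fun x => ?_
  have hslice : ∀ f : Fib d, Summable fun u : Site (d + 1) => w u * (E u yw.1 x a f * B x yw.2 f b) := by
    intro f
    refine Summable.of_norm_bounded ((hc yw.1 δ hδ).mul_left (CE * CB)) (fun u => ?_)
    rw [Real.norm_eq_abs, abs_mul, abs_mul]
    have h1 : |E u yw.1 x a f| ≤ CE * Real.exp (-δ * l1 (c u - yw.1)) := by
      refine (hE u yw.1 x a f).trans (mul_le_mul_of_nonneg_left (Real.exp_le_exp.mpr ?_) hCE)
      rw [l1_sub_symm (c u) yw.1]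
      nlinarith [l1_nonneg (x - c u), hδ.le]
    have h2 : |B x yw.2 f b| ≤ CB := by
      refine (hB x yw.2 f b).trans ?_
      have : Real.exp (-δ * (l1 (x - q) + l1 (yw.2 - q))) ≤ 1 := by
        rw [Real.exp_le_one_iff]; nlinarith [l1_nonneg (x - q), l1_nonneg (yw.2 - q), hδ.le]
      nlinarith
    calc |w u| * (|E u yw.1 x a f| * |B x yw.2 f b|) ≤ 1 * ((CE * Real.exp (-δ * l1 (c u - yw.1))) * CB) :=
          mul_le_mul (hw _) (mul_le_mul h1 h2 (abs_nonneg _) ((abs_nonneg _).trans h1)) (mul_nonneg (abs_nonneg _) (abs_nonneg _)) zero_le_one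
      _ = CE * CB * Real.exp (-δ * l1 (c u - yw.1)) := by ring
  rw [Summable.tsum_finsetSum (fun f _ => hslice f)]
  refine Finset.sum_congr rfl fun f _ => ?_
  rw [← tsum_mul_right]
  exact tsum_congr fun u => by ring

end Expose

/-! ## §3 The pushes -/

section Push

variable {Lc : ℕ} {X Dl Er : MKer (d + 1) (Fib d)} {D S : Fin (d + 1) → Site (d + 1) → MKer (d + 1) (Fib d)} {p q : Site (d + 1)}
  {CX C₁ CD Cs δ : ℝ}

/-- [folklore] The centres `Lc•u` of the coarse bonds are admissible: `Σ_u e^{−ε|Lc•u − q|₁} < ∞` (`KernelLegCharges.summable_exp_coarse`). -/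
theorem summable_exp_centre_coarse (hLc : 1 ≤ Lc) (q : Site (d + 1)) (ε : ℝ) (hε : 0 < ε) :
    Summable fun u : Site (d + 1) => Real.exp (-ε * l1 ((Lc : ℤ) • u - q)) :=
  KernelLegCharges.summable_exp_coarse hLc hε q

/-- [folklore] The centres `t` of the fine bonds are admissible: `Σ_t e^{−ε|t − q|₁} < ∞`. -/
theorem summable_exp_centre_fine (q : Site (d + 1)) (ε : ℝ) (hε : 0 < ε) :
    Summable fun t : Site (d + 1) => Real.exp (-ε * l1 (t - q)) :=
  summable_exp_shift' hε q

/-- NOT IN PRINT; OUR BOOKKEEPING.  **THE RIGHT BOND PUSH THROUGH THE FACE PAIRING**: for a left factor `Dl` bi-localised at `(p,p)`, a decaying `X`, a coarse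
bond family `D ν u` uniformly bi-localised at `Lc•u`, a local fine family `S`, bounded weights, and the ENTRYWISE push law `hpush`
(`Σ'_u w u·D ν u = K·Σ'_t w′ t·S ν t`, K1a's shape), `Σ'_u w u·Σ'_{(y,w′)} m·((Dl ∘ X) ∘ D ν u)(y,w′)(a,b) = K·Σ'_t w′ t·Σ'_{(y,w′)} m·((Dl ∘ X) ∘ S ν t)(y,w′)(a,b)`. -/
theorem push_right_facePair (hLc : 1 ≤ Lc) (hDl : BiLoc Dl p p C₁ δ) (hX : Decays X CX δ) (hδ : 0 < δ)
    (hD : ∀ κ u, BiLoc (D κ u) ((Lc : ℤ) • u) ((Lc : ℤ) • u) CD δ) (hS : LocStencil S Cs δ) (ν : Fin (d + 1))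
    (w : Site (d + 1) → ℝ) (hw : ∀ u, |w u| ≤ 1) (w' : Site (d + 1) → ℝ) (hw' : ∀ t, |w' t| ≤ 1) (K : ℝ)
    (hpush : ∀ (x z : Site (d + 1)) (a b : Fib d), ∑' u : Site (d + 1), w u * D ν u x z a b = K * ∑' t : Site (d + 1), w' t * S ν t x z a b)
    (m : Site (d + 1) × Site (d + 1) → ℝ) (hm : ∀ yw, |m yw| ≤ 1) (a b : Fib d) :
    ∑' u : Site (d + 1), w u * ∑' yw : Site (d + 1) × Site (d + 1), m yw * comp (comp Dl X) (D ν u) yw.1 yw.2 a b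
      = K * ∑' t : Site (d + 1), w' t * ∑' yw : Site (d + 1) × Site (d + 1), m yw * comp (comp Dl X) (S ν t) yw.1 yw.2 a b := by
  have hCs : 0 ≤ Cs := (hS ν 0).nonneg a
  have hA : BiLoc (comp Dl X) p p ((Fintype.card (Fib d) : ℝ) * (C₁ * CX) * Zl (d + 1) (δ - δ / 2)) (δ / 2) :=
    biLoc_comp_right hDl hX (by positivity) (by linarith)
  have hD' : ∀ u, BiLoc (D ν u) ((Lc : ℤ) • u) ((Lc : ℤ) • u) CD (δ / 2) := fun u => biLoc_mono (hD ν u) ((hD ν u).nonneg a) (by linarith)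
  have hS' : ∀ t, BiLoc (S ν t) t t Cs (δ / 2) := fun t => biLoc_mono (hS ν t) hCs (by linarith)
  rw [tsum_weight_facePair_comp_right (A := comp Dl X) (E := D ν) (c := fun u => (Lc : ℤ) • u) hA hD' (half_pos hδ)
      (summable_exp_centre_coarse hLc) w hw m hm a b,
    tsum_weight_facePair_comp_right (A := comp Dl X) (E := S ν) (c := fun t => t) hA hS' (half_pos hδ)
      summable_exp_centre_fine w' hw' m hm a b]
  simp_rw [hpush]
  rw [← tsum_mul_left]
  exact tsum_congr fun yw => pull_const_right (m yw) K (fun x' f => comp Dl X yw.1 x' a f) (fun x' f => ∑' t : Site (d + 1), w' t * S ν t x' yw.2 f b)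

/-- NOT IN PRINT; OUR BOOKKEEPING.  **THE LEFT BOND PUSH THROUGH THE FACE PAIRING**: for a right factor `Er` bi-localised at `(q,q)`, a decaying `X`, a coarse
bond family `D μ u` uniformly bi-localised at `Lc•u`, a local fine family `S`, bounded weights, and the entrywise push law `hpush`,
`Σ'_u w u·Σ'_{(y,w′)} m·((D μ u ∘ X) ∘ Er)(y,w′)(a,b) = K·Σ'_t w′ t·Σ'_{(y,w′)} m·((S μ t ∘ X) ∘ Er)(y,w′)(a,b)` (`comp_assoc_bdb` twice + §2). -/
theorem push_left_facePair (hLc : 1 ≤ Lc) (hEr : BiLoc Er q q C₁ δ) (hX : Decays X CX δ) (hδ : 0 < δ)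
    (hD : ∀ κ u, BiLoc (D κ u) ((Lc : ℤ) • u) ((Lc : ℤ) • u) CD δ) (hS : LocStencil S Cs δ) (μ : Fin (d + 1))
    (w : Site (d + 1) → ℝ) (hw : ∀ u, |w u| ≤ 1) (w' : Site (d + 1) → ℝ) (hw' : ∀ t, |w' t| ≤ 1) (K : ℝ)
    (hpush : ∀ (x z : Site (d + 1)) (a b : Fib d), ∑' u : Site (d + 1), w u * D μ u x z a b = K * ∑' t : Site (d + 1), w' t * S μ t x z a b)
    (m : Site (d + 1) × Site (d + 1) → ℝ) (hm : ∀ yw, |m yw| ≤ 1) (a b : Fib d) :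
    ∑' u : Site (d + 1), w u * ∑' yw : Site (d + 1) × Site (d + 1), m yw * comp (comp (D μ u) X) Er yw.1 yw.2 a b
      = K * ∑' t : Site (d + 1), w' t * ∑' yw : Site (d + 1) × Site (d + 1), m yw * comp (comp (S μ t) X) Er yw.1 yw.2 a b := by
  have hCs : 0 ≤ Cs := (hS μ 0).nonneg a
  have hCD : 0 ≤ CD := (hD μ 0).nonneg a
  -- associativity on both sides
  have hassocD : ∀ u, comp (comp (D μ u) X) Er = comp (D μ u) (comp X Er) := fun u => (comp_assoc_bdb (hD μ u) hX hEr hδ).symm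
  have hassocS : ∀ t, comp (comp (S μ t) X) Er = comp (S μ t) (comp X Er) := fun t => (comp_assoc_bdb (hS μ t) hX hEr hδ).symm
  simp_rw [hassocD, hassocS]
  have hB : BiLoc (comp X Er) q q ((Fintype.card (Fib d) : ℝ) * (CX * C₁) * Zl (d + 1) (δ - δ / 2)) (δ / 2) :=
    biLoc_comp_decays hX hEr (by positivity) (by linarith)
  have hD' : ∀ u, BiLoc (D μ u) ((Lc : ℤ) • u) ((Lc : ℤ) • u) CD (δ / 2) := fun u => biLoc_mono (hD μ u) hCD (by linarith)
  have hS' : ∀ t, BiLoc (S μ t) t t Cs (δ / 2) := fun t => biLoc_mono (hS μ t) hCs (by linarith)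
  rw [tsum_weight_facePair_comp_left (B := comp X Er) (E := D μ) (c := fun u => (Lc : ℤ) • u) hB hD' (half_pos hδ)
      (summable_exp_centre_coarse hLc) w hw m hm a b,
    tsum_weight_facePair_comp_left (B := comp X Er) (E := S μ) (c := fun t => t) hB hS' (half_pos hδ)
      summable_exp_centre_fine w' hw' m hm a b]
  simp_rw [hpush]
  rw [← tsum_mul_left]
  exact tsum_congr fun yw => pull_const_left (m yw) K (fun x f => ∑' t : Site (d + 1), w' t * S μ t yw.1 x a f) (fun x f => comp X Er x yw.2 f b)

end Push

end Summit.QuantumFields.BalabanUV.Beta.GAN24.FaceWordBondPush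

end
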